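import Summits.HubbardSuperconductivity.HubbardSuperconductivity.Theorems.AnisotropyChordTransferFibre3RowDPiHatExpansion
import Summits.HubbardSuperconductivity.HubbardSuperconductivity.Theorems.AnisotropyChordTransferFibre3RowDConvolution
import Summits.HubbardSuperconductivity.HubbardSuperconductivity.Theorems.AnisotropyChordTransferFibre3RowDFourier
import Summits.HubbardSuperconductivity.HubbardSuperconductivity.Theorems.AnisotropyChordTransferFibre3RowDConvExpansionU

/-!
# Route `AnisotropyChord` / H0 rotor rung: the pair transform `Y_e(q)` at one loop (row D, per-`L` evaluator XD)

The analytic identity behind the `Y`-table of `…Fibre3FinXDEval`: for a two-magnon profile with `λ₂ < 2ε₁` (the ground profile) and a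
nonzero lattice vector `e`,
  `V·Y_e(q) = A²·[q = 0] + A·B(q)·(1 + e^{−iq·e}) + a c_s V G̃(e)·(1 + e^{−iq·e}) + c_s²·e^{−iq·e}·W_e(q)`,
`Y_e(q) = Σ_b e^{−iq·b} f(b) f(b−e)` (`Yfun`), `A = V + a`, `B(q) = −a − c_s g(q)` (`Bhat`), `W_e(q) = Σ_p e^{ip·e} g(p) g(q−p)` (`WE`):
`pairConvolution_holds` + `shiftTransform_holds` + `fhat_closed`, the `δ`-collapses, `Σ_s e^{−is·e} = 0`, and ★ `sum_phase_gres`: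
`Σ_s e^{is·e} g(s) = V·G̃(e)` (real by evenness of `g`).  Also the direction reductions `WE (−e) q = conj (WE e q)`,
`WE ŷ (q₁,q₂) = WE x̂ (q₂,q₁)` and `G̃` on the four nearest neighbours.
Prover seat `hubbard-h0-rotor-p3` g7; helper for piece A = stmt-HubbardSuperconductivity-23918 of rung 19089 (`--supports`, helper class).
WHAT THIS IS NOT: nothing here proves superconductivity in the Hubbard model (rotor TARGET as worded stays FALSE, g15 verdict); one identity
for ONE row of ONE conditional reduction.  Tree imports only; no sorry, no new axioms.
-/

set_option linter.dupNamespace false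
set_option autoImplicit false

namespace Summit.HubbardSuperconductivity.HubbardSuperconductivity.Theorems.AnisotropyChord.Transfer.Fibre3

namespace FinXD

open scoped BigOperators
open Finset RowD

variable (L : ℕ) [NeZero L]

/-- the twisted two-propagator sum `W_e(q) := Σ_p e^{ip·e} g(p) g(q − p)`. -/
noncomputable def WE (lam2 : ℝ) (e q : Tor L) : ℂ :=
  ∑ p : Tor L, phase L p e * ((gres L lam2 p * gres L lam2 (q - p) : ℝ) : ℂ)

/-- `Σ_s e^{is·e} g(s)` is invariant under conjugation (evenness of `g`), hence real. [folklore] -/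
theorem conj_sum_phase_gres (lam2 : ℝ) (e : Tor L) :
    (starRingEnd ℂ) (∑ s : Tor L, phase L s e * ((gres L lam2 s : ℝ) : ℂ))
      = ∑ s : Tor L, phase L s e * ((gres L lam2 s : ℝ) : ℂ) := by
  rw [map_sum]
  have h1 : ∀ s : Tor L, (starRingEnd ℂ) (phase L s e * ((gres L lam2 s : ℝ) : ℂ))
      = phase L (-s) e * ((gres L lam2 (-s) : ℝ) : ℂ) := by
    intro s
    rw [map_mul, Complex.conj_ofReal, phase_comm L s e, conj_phase, phase_comm L e (-s), B1.gres_neg]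
  simp_rw [h1]
  exact Fintype.sum_equiv (Equiv.neg (Tor L)) _ _ (fun s => rfl)

/-- ★ `Σ_s e^{is·e} g(s) = V·G̃(e)`. [folklore] -/
theorem sum_phase_gres (lam2 : ℝ) (e : Tor L) :
    (∑ s : Tor L, phase L s e * ((gres L lam2 s : ℝ) : ℂ)) = ((((L : ℝ) ^ 2 * Gres L lam2 e : ℝ)) : ℂ) := by
  set S := ∑ s : Tor L, phase L s e * ((gres L lam2 s : ℝ) : ℂ) with hS
  have hreal : S = ((S.re : ℝ) : ℂ) := by
    have h := conj_sum_phase_gres L lam2 e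
    rw [← hS] at h
    exact (Complex.conj_eq_iff_re.mp h).symm
  have hre : S.re = (L : ℝ) ^ 2 * Gres L lam2 e := by
    have hV : ((L : ℝ) ^ 2) ≠ 0 := pow_ne_zero 2 (Nat.cast_ne_zero.mpr (NeZero.ne L))
    unfold Gres
    rw [mul_div_cancel₀ _ hV, hS, Complex.re_sum]
    refine Finset.sum_congr rfl fun s _ => ?_
    rw [Complex.re_mul_ofReal, mul_comm]
  rw [hreal, hre]

/-- `Σ_s e^{−is·e} = 0` for `e ≠ 0`. [folklore] -/
theorem sum_conj_phase_ne (e : Tor L) (he : e ≠ 0) : (∑ s : Tor L, (starRingEnd ℂ) (phase L s e)) = 0 := by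
  rw [← map_sum, show (∑ s : Tor L, phase L s e) = 0 by rw [sum_phase_left]; simp [he], map_zero]

/-- `e^{−i(q−p)·e} = e^{−iq·e} e^{ip·e}`. [folklore] -/
theorem conj_phase_sub (q p e : Tor L) :
    (starRingEnd ℂ) (phase L (q - p) e) = (starRingEnd ℂ) (phase L q e) * phase L p e := by
  have h : phase L (q - p) e * phase L p e = phase L q e := phase_sub_left_mul L q p e
  have hp : phase L p e * (starRingEnd ℂ) (phase L p e) = 1 := by
    rw [phase_comm, conj_phase, phase_mul_neg]
  calc (starRingEnd ℂ) (phase L (q - p) e)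
      = (starRingEnd ℂ) (phase L (q - p) e) * (phase L p e * (starRingEnd ℂ) (phase L p e)) := by rw [hp, mul_one]
    _ = (starRingEnd ℂ) (phase L (q - p) e * phase L p e) * phase L p e := by rw [map_mul]; ring
    _ = (starRingEnd ℂ) (phase L q e) * phase L p e := by rw [h]

/-- ★ THE ONE-LOOP FORM OF `Y_e(q)` (two-magnon profile, `λ₂ < 2ε₁`, `e ≠ 0`). [folklore] -/
theorem yfun_oneloop (hL : 3 ≤ L) {Δ lam2 : ℝ} {f : Tor L → ℝ} (hf : IsTwoMagnon L Δ lam2 f) (hl2 : lam2 < 2 * eps1 L)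
    (e q : Tor L) (he : e ≠ 0) :
    ((L : ℂ) ^ 2) * Yfun L f e q
      = ((((L : ℝ) ^ 2 + Δ * f (K1 L)) ^ 2 : ℝ) : ℂ) * (if q = 0 then (1 : ℂ) else 0)
        + ((((L : ℝ) ^ 2 + Δ * f (K1 L)) * Bhat L Δ lam2 f q : ℝ) : ℂ) * (1 + (starRingEnd ℂ) (phase L q e))
        + ((Δ * f (K1 L) * cS L Δ lam2 f * ((L : ℝ) ^ 2 * Gres L lam2 e) : ℝ) : ℂ) * (1 + (starRingEnd ℂ) (phase L q e))
        + ((cS L Δ lam2 f ^ 2 : ℝ) : ℂ) * (starRingEnd ℂ) (phase L q e) * WE L lam2 e q := by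
  have hV : (L : ℂ) ^ 2 ≠ 0 := pow_ne_zero 2 (Nat.cast_ne_zero.mpr (NeZero.ne L))
  -- `Y = pairZ f f(·−e)` and the pair convolution
  have hY : Yfun L f e q = pairZ L f (fun r => f (r - e)) q := rfl
  rw [hY, pairConvolution_holds L f (fun r => f (r - e)) q, mul_div_cancel₀ _ hV]
  set A : ℂ := (((L : ℝ) ^ 2 + Δ * f (K1 L) : ℝ) : ℂ) with hA
  set Bc : Tor L → ℂ := fun p => ((Bhat L Δ lam2 f p : ℝ) : ℂ) with hBc
  set F : Tor L → ℂ := dft L f with hF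
  set c : Tor L → ℂ := fun s => (starRingEnd ℂ) (phase L s e) with hc
  have hFp : ∀ p, F p = A * (if p = 0 then 1 else 0) + Bc p := fun p => fhat_delta_form L hL hf hl2 p
  have hshift : ∀ s, dft L (fun r => f (r - e)) s = c s * F s := fun s => (shiftTransform_holds L f e s).1
  simp_rw [hshift]
  -- step 1: the first factor's δ
  have h1 : (∑ p : Tor L, F p * (c (q - p) * F (q - p))) = A * (c q * F q) + ∑ p : Tor L, Bc p * (c (q - p) * F (q - p)) := by
    have : ∀ p : Tor L, F p * (c (q - p) * F (q - p))
        = A * ((if p = 0 then (1 : ℂ) else 0) * (c (q - p) * F (q - p))) + Bc p * (c (q - p) * F (q - p)) := by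
      intro p; rw [hFp p]; ring
    simp_rw [this]
    rw [Finset.sum_add_distrib, ← Finset.mul_sum, sum_delta_zero L (fun p => c (q - p) * F (q - p))]
    simp only [sub_zero]
  -- step 2: the second factor's δ
  have h2 : (∑ p : Tor L, Bc p * (c (q - p) * F (q - p))) = A * Bc q + ∑ p : Tor L, Bc p * Bc (q - p) * c (q - p) := by
    have : ∀ p : Tor L, Bc p * (c (q - p) * F (q - p))
        = A * ((if q - p = 0 then (1 : ℂ) else 0) * (Bc p * c (q - p))) + Bc p * Bc (q - p) * c (q - p) := by
      intro p; rw [hFp (q - p)]; ring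
    simp_rw [this]
    rw [Finset.sum_add_distrib, ← Finset.mul_sum, sum_delta_sub L q (fun p => Bc p * c (q - p))]
    have hc0 : c (q - q) = 1 := by rw [hc]; simp only [sub_self, phase_zero_left, map_one]
    rw [hc0, mul_one]
  -- step 3: the `BB` sum
  set a : ℝ := Δ * f (K1 L) with ha
  set cs : ℝ := cS L Δ lam2 f with hcs
  have hBdef : ∀ p, Bc p = -(a : ℂ) - (cs : ℂ) * ((gres L lam2 p : ℝ) : ℂ) := by
    intro p
    show ((Bhat L Δ lam2 f p : ℝ) : ℂ) = _
    unfold Bhat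
    rw [← ha, ← hcs]
    push_cast
    ring
  have hcsub : ∀ p, c (q - p) = c q * phase L p e := fun p => conj_phase_sub L q p e
  have h3 : (∑ p : Tor L, Bc p * Bc (q - p) * c (q - p))
      = (a : ℂ) ^ 2 * (∑ s : Tor L, c s)
        + (a : ℂ) * (cs : ℂ) * ((∑ s : Tor L, c s * ((gres L lam2 s : ℝ) : ℂ)) + c q * ∑ p : Tor L, phase L p e * ((gres L lam2 p : ℝ) : ℂ))
        + (cs : ℂ) ^ 2 * c q * WE L lam2 e q := by
    have hsplit : ∀ p : Tor L, Bc p * Bc (q - p) * c (q - p)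
        = (a : ℂ) ^ 2 * c (q - p)
          + (a : ℂ) * (cs : ℂ) * (c (q - p) * ((gres L lam2 (q - p) : ℝ) : ℂ) + c q * (phase L p e * ((gres L lam2 p : ℝ) : ℂ)))
          + (cs : ℂ) ^ 2 * c q * (phase L p e * ((gres L lam2 p * gres L lam2 (q - p) : ℝ) : ℂ)) := by
      intro p; rw [hBdef p, hBdef (q - p)]
      have := hcsub p
      push_cast
      rw [this]; ring
    simp_rw [hsplit]
    rw [Finset.sum_add_distrib, Finset.sum_add_distrib, ← Finset.mul_sum, ← Finset.mul_sum, ← Finset.mul_sum,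
      Finset.sum_add_distrib, ← Finset.mul_sum]
    have hs1 : (∑ p : Tor L, c (q - p)) = ∑ s : Tor L, c s :=
      Fintype.sum_equiv (Equiv.subLeft q) _ _ (fun p => by simp)
    have hs2 : (∑ p : Tor L, c (q - p) * ((gres L lam2 (q - p) : ℝ) : ℂ)) = ∑ s : Tor L, c s * ((gres L lam2 s : ℝ) : ℂ) :=
      Fintype.sum_equiv (Equiv.subLeft q) _ _ (fun p => by simp)
    rw [hs1, hs2]
    unfold WE
    rfl
  -- the character sums
  have hc_sum : (∑ s : Tor L, c s) = 0 := sum_conj_phase_ne L e he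
  have hcg : (∑ s : Tor L, c s * ((gres L lam2 s : ℝ) : ℂ)) = ((((L : ℝ) ^ 2 * Gres L lam2 e : ℝ)) : ℂ) := by
    have h := conj_sum_phase_gres L lam2 e
    rw [map_sum] at h
    have h' : (∑ s : Tor L, c s * ((gres L lam2 s : ℝ) : ℂ)) = ∑ s : Tor L, (starRingEnd ℂ) (phase L s e * ((gres L lam2 s : ℝ) : ℂ)) := by
      refine Finset.sum_congr rfl fun s _ => ?_
      rw [map_mul, Complex.conj_ofReal]
    rw [h', h, sum_phase_gres]
  rw [h1, h2, h3, hc_sum, hcg, sum_phase_gres, hFp q]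
  have hδ : c q * (if q = 0 then (1 : ℂ) else 0) = (if q = 0 then (1 : ℂ) else 0) := by
    by_cases hq : q = 0
    · rw [if_pos hq, hq, hc]; simp only [phase_zero_left, map_one, mul_one]
    · rw [if_neg hq, mul_zero]
  have e1 : (starRingEnd ℂ) (phase L q e) = c q := rfl
  rw [e1, hA, hBc]
  simp only
  push_cast
  linear_combination ((((L : ℝ) : ℂ) ^ 2 + (a : ℂ)) ^ 2) * hδ

/-! ## Direction reductions -/

/-- `W_{−e}(q) = conj W_e(q)`. [folklore] -/
theorem WE_neg (lam2 : ℝ) (e q : Tor L) : WE L lam2 (-e) q = (starRingEnd ℂ) (WE L lam2 e q) := by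
  unfold WE
  rw [map_sum]
  refine Finset.sum_congr rfl fun p _ => ?_
  rw [map_mul, Complex.conj_ofReal, phase_comm L p (-e), phase_neg_left, ← conj_phase, phase_comm]

/-- `W_{ŷ}(q₁,q₂) = W_{x̂}(q₂,q₁)` (swap symmetry of `g`). [folklore] -/
theorem WE_swap (lam2 : ℝ) (q : Tor L) : WE L lam2 (ey L) q = WE L lam2 (ex L) (q.2, q.1) := by
  unfold WE
  refine Fintype.sum_equiv (Equiv.prodComm (ZMod L) (ZMod L)) _ _ (fun p => ?_)
  simp only [Equiv.prodComm_apply, Prod.swap]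
  have hg1 : gres L lam2 (p.2, p.1) = gres L lam2 p := gres_swap L lam2 p
  have hg2 : gres L lam2 ((q.2, q.1) - (p.2, p.1)) = gres L lam2 (q - p) := by
    have : ((q.2, q.1) - (p.2, p.1) : Tor L) = ((q - p).2, (q - p).1) := by ext <;> simp
    rw [this, gres_swap]
  have hph : phase L (p.2, p.1) (ex L) = phase L p (ey L) := by
    unfold phase ex ey
    congr 3
    push_cast
    simp
  rw [hg1, hg2, hph]

/-- `G̃` takes the same value on the four nearest neighbours. [folklore] -/
theorem Gres_dirs (lam2 : ℝ) :
    Gres L lam2 (-ex L) = Gres L lam2 (ex L) ∧ Gres L lam2 (ey L) = Gres L lam2 (ex L) ∧ Gres L lam2 (-ey L) = Gres L lam2 (ex L) := by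
  have h1 := Gres_neg L lam2 (ex L)
  have h2 : Gres L lam2 (ey L) = Gres L lam2 (ex L) := by
    have := Gres_swap L lam2 (ey L)
    unfold ey ex at *
    simpa using this.symm
  have h3 := Gres_neg L lam2 (ey L)
  exact ⟨h1, h2, by rw [h3, h2]⟩

end FinXD

end Summit.HubbardSuperconductivity.HubbardSuperconductivity.Theorems.AnisotropyChord.Transfer.Fibre3
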